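import Literature.AlgebraicGeometry.Shioda1982.ExceptionalQuadruplesComplete
import HarnessLib

/-!
# Shioda 1982 / Meyer–Neutsch 1981: no exceptional quadruple at the level `N = 396` — kernel sweep, part 4 of 7

Topic `Literature/AlgebraicGeometry/Shioda1982`; companion of `ExceptionalQuadruplesComplete.lean` (search `checkB`, soundness
`tabelleOneCompleteAt_of_chunks`, invariant form `exists_mem_reps_of_isExceptionalQuadruple`, statement `TabelleOneCompleteAt`; sources,
method and framing in its module docstring) and of the series `ExceptionalQuadruplesSweep*.lean` (together: every level `2 ≤ N ≤ 180`
that is not a row of Tabelle 1; `…SweepTwoHundredTwenty.lean`: `N = 220`). THEOREMS only (no definition, no named fact): the same kernel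
search at the single level `N = 396`, which carries NO row of [MeyerNeutsch1981Fermatquadrupel, Tabelle 1] (computer-generated there,
"alle Fermatquadrupel für N ≤ 614 ermittelt", §2 p. 53) and lies above the range `N ≤ 180` of Shioda's table p. 727 — by Aoki's
Theorem C ([Aoki1983], computer-assisted for `181 ≤ m ≤ 672`) there is no exceptional element at any level `> 180`; the files
`ExceptionalQuadruplesSweepThreeHundredNinetySixPartOne.lean`, `ExceptionalQuadruplesSweepThreeHundredNinetySixPartTwo.lean`, `ExceptionalQuadruplesSweepThreeHundredNinetySixPartThree.lean`, `ExceptionalQuadruplesSweepThreeHundredNinetySixPartFour.lean`, `ExceptionalQuadruplesSweepThreeHundredNinetySixPartFive.lean`, `ExceptionalQuadruplesSweepThreeHundredNinetySixPartSix.lean`, `ExceptionalQuadruplesSweepThreeHundredNinetySix.lean` make the instance `N = 396` a kernel statement. The search at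
`N = 396` visits 1744611 candidate triples (`φ(396) − 1 = 119` units each), too many for one elaboration of bounded wall time, so the
chunks of first entries are spread over 7 files: `ExceptionalQuadruplesSweepThreeHundredNinetySixPartOne.lean` — first entries `0 ≤ a < 18` (243837 candidates);
`ExceptionalQuadruplesSweepThreeHundredNinetySixPartTwo.lean` — first entries `18 ≤ a < 35` (240860 candidates);
`ExceptionalQuadruplesSweepThreeHundredNinetySixPartThree.lean` — first entries `35 ≤ a < 53` (256017 candidates);
`ExceptionalQuadruplesSweepThreeHundredNinetySixPartFour.lean` — first entries `53 ≤ a < 71` (246540 candidates);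
`ExceptionalQuadruplesSweepThreeHundredNinetySixPartFive.lean` — first entries `71 ≤ a < 91` (249814 candidates);
`ExceptionalQuadruplesSweepThreeHundredNinetySixPartSix.lean` — first entries `91 ≤ a < 115` (246258 candidates);
`ExceptionalQuadruplesSweepThreeHundredNinetySix.lean` — first entries `115 ≤ a < 396` (261285 candidates); the last one assembles
`completeAt_threeHundredNinetySix` (every sorted pair-free primitive Hodge 4-multiset mod `396` is standard) and `not_isExceptionalQuadruple_threeHundredNinetySix`.
WHY THIS LEVEL (cell `pub-hfermat`): `396 = 36·11`, the instance `p = 11` of the family `m = 36p` of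
`HodgeQuadruplesThirtySixPrime.lean` (`classify_hodgeMultiset_thirtySixPrime`, `p ≥ 19`) below its range — a residual prime of the
companion `PicardNumberThirtySixPrime.lean` (`exceptional_thirtySixPrime`). `decide +kernel` only (no `native_decide`).

HONEST FRAMING (cell `pub-hfermat`): explicit algebraic cycles for specific Hodge classes on Fermat/Delsarte varieties; residual open
instances listed; no claim on general Hodge. These classes are algebraic (Lefschetz (1,1)); certified here is only the emptiness of the
exceptional list at this level.

## References
* [MeyerNeutsch1981Fermatquadrupel] W. Meyer, W. Neutsch, *Fermatquadrupel*, Math. Ann. 256 (1981) 51–62, §2 p. 53, Tabelle 1 p. 54 (no row 396).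
* [Shioda1982PicardFermat] T. Shioda, J. Fac. Sci. Univ. Tokyo IA 28 (1982) 725–734, table p. 727 (levels `≤ 180`), Prop. 4 (Q′) p. 729.
* [Aoki1983] N. Aoki, Math. Ann. 266 (1983) 23–54, Thm. C.
-/

namespace Literature.AlgebraicGeometry.Shioda1982

open Literature.AlgebraicGeometry.HodgeTheory

set_option maxHeartbeats 0 in
/-- **The search at `N = 396` passes on the first entries `53 ≤ a < 71`** (part 4 of 7: 18 chunks, 246540 candidate
triples): every visited sorted quadruple of representatives there fails the Hodge test or is standard (`checkB`; `reps 396 = []`).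
[cite: MeyerNeutsch1981Fermatquadrupel, §2 p. 53 ("alle Fermatquadrupel für N ≤ 614 ermittelt") and Tabelle 1 p. 54 (no row 396)]
[cite: Aoki1983, Thm. C] -/
theorem checkB_threeHundredNinetySix_partFour :
    ∀ p ∈ ([(53, 1), (54, 1), (55, 1), (56, 1), (57, 1), (58, 1), (59, 1), (60, 1), (61, 1), (62, 1), (63, 1), (64, 1), (65, 1), (66, 1), (67, 1), (68, 1), (69, 1), (70, 1)] : List (ℕ × ℕ)), checkB 396 p.1 p.2 = true := by
  intro p hp
  simp only [List.mem_cons, List.not_mem_nil, or_false] at hp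
  rcases hp with rfl | rfl | rfl | rfl | rfl | rfl | rfl | rfl | rfl | rfl | rfl | rfl | rfl | rfl | rfl | rfl | rfl | rfl <;> decide +kernel

end Literature.AlgebraicGeometry.Shioda1982
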